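import Literature.LinearAlgebra.RootSystem.AffineWeylGroupOmegaOrder
import Literature.LinearAlgebra.RootSystem.AffineWeylGroupPoincareSeries
import Literature.LinearAlgebra.RootSystem.MinusculeWeightsRootLatticeRepresentatives
import Literature.LinearAlgebra.RootSystem.WeightLatticeIndex
import HarnessLib

/-!
# The order of `Ω`: `|Ω| = [P : P_r] = |det C| = 1 + N₁`; `Ω` is finite and `W_a` has finite index in `Ŵ_a` (Iwahori–Matsumoto 1965 §1.7, Corollary 1.19)

N. Iwahori, H. Matsumoto, *On some Bruhat decomposition and the structure of the Hecke rings of p-adic Chevalley groups*, Publ. Math. IHÉS 25 (1965)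
[IwahoriMatsumoto1965] (held `paper:doi-10-1007-bf02684396`, p0012–p0013 = pp. 247–248), §1.7: «Hence we have `Ω ≅ DW/D'W ≅ D/D' ≅ P/P_r = 𝔷`. Thus `Ω`
is a finite abelian group isomorphic to the center `𝔷` of `G̃_ℂ` … **Corollary 1.19.** The order of the group `Ω` (i.e. the index `[P : P_r]`) is equal to
`1 + N₁` where `N₁` is the number of `i`'s such that `(α₀, ε_i) = 1`.»  J. E. Humphreys, *Introduction to Lie Algebras and Representation Theory*
[Humphreys1972], §13.1: «`Λ/Λ_r` must be a finite group (called the fundamental group of `Φ`) … its determinant … measures the index of `Λ_r` in `Λ`».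
J. E. Humphreys, *Reflection Groups and Coxeter Groups* [Humphreys1990], §4.5: «`Ŵ_a/W_a ≅ L̂/L`. … This makes it easy to determine its order `f`,
called the **index of connection** … it is just the determinant of the matrix of Cartan integers».

THIS FILE (lane `lit-hodgefound`, prover seat p40, generation 47, row g47-#6; THEOREMS ONLY — no definition, instance, notation or named fact; net
debt 0) assembles Corollary 1.19 in the vocabulary of the `AffineWeylGroup*` files (weight space `M`; `W_a` translates by `Q = P.rootSpan ℤ` = IM's
`P_r`, `Ŵ_a` by `P(Φ) = weightLattice P` = IM's `P`; `Ω = {o ∈ Ŵ_a | oA∘ = A∘}` as a subtype; row g45-#10 gave `|Ω| = [Ŵ_a : W_a] = [P(Φ) : Q]` as a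
`Nat.card` ∕ `relIndex` identity, «both sides `0` together when infinite»): a dual family of fundamental weights `ϖ` (`⟨ϖ_i, α_j^∨⟩ = δ_ij`, tree
`FundamentalWeights`) exhibits `P(Φ) = ⊕ ℤϖ_i`, so `[P(Φ) : Q] = |det C|` (tree `FundamentalGroupOrder`, Humphreys §13.1) is a genuine positive
integer: `Ω` IS FINITE, `W_a` HAS FINITE INDEX `|det C|` IN `Ŵ_a`, and `|Ω| = 1 + N₁` with `N₁` the number of special (minuscule) nodes (tree
`card_filter_coeff_eq_one_eq_natAbs_det_sub_one`, Bourbaki VIII §7 no. 3 Prop. 8).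

* §1 ★ **`weightLattice_eq_span_fundamental`** (`P(Φ) = span ℤ {ϖ_i}` — the weight lattice of row g44-#1 is the lattice `Λ` of the `FundamentalWeights` files).
* §2 ★★★ **`natCard_stabilizer_eq_natAbs_det`** (`|Ω| = |det C|`), ★★★ **`relIndex_affineWeylGroup_eq_natAbs_det`** («`Ŵ_a/W_a` … its order `f` … is
  just the determinant of the matrix of Cartan integers»: `[Ŵ_a : W_a] = |det C|`), ★★ **`finite_stabilizer`** («`Ω` is a finite abelian group»: FINITE;
  abelian is row g44-#11 `stabilizer_mul_comm`), ★★ **`relIndex_affineWeylGroup_ne_zero`** (`W_a` has finite index in `Ŵ_a`).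
* §3 ★★★ **`natCard_stabilizer_eq_one_add_card_filter`** (COROLLARY 1.19 AS PRINTED, irreducible `Φ`: `|Ω| = 1 + N₁`, `N₁ = #{i ∈ Δ : n_i = 1}` for the
  highest coroot `α_η^∨ = Σ n_i α_i^∨` — the special nodes of row g45-#7).
* §4 ★★ **`ncard_extendedAffineWeylGroup_sep_eq_natAbs_det_mul`** (with row g47-#3: the number of `σ ∈ Ŵ_a` at separating-distance `n` from `A∘` is
  `|det C| · Card {w ∈ W_a | ℓ(w) = n}` — «`P(DW, t) = |Ω|·P(D'W, t)`» with `|Ω|` evaluated).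

BY NAME, nothing restated: rows g44-#1 (`weightLattice`, `extendedAffineWeylGroup`, `affineWeylGroup`), g44-#4 (`relIndex_affineWeylGroup_extendedAffineWeylGroup`),
g45-#10 (`natCard_stabilizer_eq_relIndex`, `natCard_stabilizer_eq_relIndex_rootSpan_weightLattice`), g47-#3 (`ncard_extendedAffineWeylGroup_sep_eq`), g33
`FundamentalWeights` (`mem_span_int_fundamental_iff`), g32 `WeightLatticeIndex` (`forall_exists_int_coroot'_of_forall_mem_support`, `det_cartanMatrix_ne_zero`),
g39 `FundamentalGroupOrder` (`relIndex_rootSpan_span_fundamental_eq_natAbs_det`), g39-#4 (`card_filter_coeff_eq_one_eq_natAbs_det_sub_one`); Mathlib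
`Nat.finite_of_card_ne_zero`, `Int.natAbs_eq_zero`.

## Scope caveats

A dual family `ϖ` is a hypothesis (`hϖ`; the tree's `FundamentalWeights` §1 constructs one for a root system); §3 assumes `P` irreducible with `α_η^∨`
the highest coroot written `Σ_{j∈Δ} f_j α_j^∨` (hypothesis `hf`, as in row g39-#4). The isomorphism `Ω ≅ P/P_r` as GROUPS (not only the equality of
orders) is row g45-#10's bijection with `Ŵ_a/W_a` composed with row g44-#4 and is not restated.

## References

* [IwahoriMatsumoto1965] N. Iwahori, H. Matsumoto, Publ. Math. IHÉS 25 (1965) 5–48, §1.7 («Ω ≅ DW/D′W ≅ D/D′ ≅ P/P_r»), Corollary 1.19 (p. 248).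
* [Humphreys1990] J. E. Humphreys, *Reflection Groups and Coxeter Groups*, CUP (1990), §4.5 (index of connection `f`), §2.9.
* [Humphreys1972] J. E. Humphreys, *Introduction to Lie Algebras and Representation Theory*, Springer (1972), §13.1 (fundamental group, `det C`).
* [Bourbaki2008LieGroups79] N. Bourbaki, *Lie Groups and Lie Algebras, Chapters 7–9*, Ch. VIII §7 no. 3 Prop. 8 (minuscule weights; cite-only).
-/

noncomputable section

open Module Set Function

namespace Literature.LinearAlgebra.RootSystem

namespace Base

variable {ι K M N : Type*} [Field K] [LinearOrder K] [IsStrictOrderedRing K] [AddCommGroup M] [Module K M]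
  [AddCommGroup N] [Module K N] [Fintype ι] [DecidableEq ι]
  {P : RootPairing ι K M N} [CharZero K] [P.IsCrystallographic] [P.IsReduced] [P.IsRootSystem] (b : P.Base)
  {ϖ : b.support → M} (hϖ : ∀ i j : b.support, P.coroot' j (ϖ i) = if i = j then 1 else 0)

/-! ## §1 `P(Φ) = span ℤ {ϖ_i}` -/

section Lattice

include hϖ

omit [LinearOrder K] [IsStrictOrderedRing K] [Fintype ι] [P.IsCrystallographic] [P.IsReduced] in
/-- ★ **THE WEIGHT LATTICE IS `⊕ ℤϖ_i`**: `P(Φ) = {x | ⟨x, α^∨⟩ ∈ ℤ ∀ α} = span ℤ {ϖ_i}` (integrality on `Δ` suffices, tree g32; `span ℤ {ϖ_i}` is cut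
out by the simple coroots, tree g33). [cite: Humphreys1972, §13.1 ("Λ is a lattice with basis (λ_i, 1 ≤ i ≤ ℓ)")] [cite: Humphreys1990, §4.5 ("L̂ := {λ ∈ V | (λ, α) ∈ Z for all α ∈ Φ}")] -/
theorem weightLattice_eq_span_fundamental :
    weightLattice P = (Submodule.span ℤ (Set.range ϖ)).toAddSubgroup := by
  ext x
  rw [Submodule.mem_toAddSubgroup, mem_span_int_fundamental_iff hϖ]
  constructor
  · intro hx j _
    exact hx j
  · intro hx i
    exact forall_exists_int_coroot'_of_forall_mem_support b hx i

end Lattice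

/-! ## §2 `|Ω| = [Ŵ_a : W_a] = |det C|`; `Ω` is finite -/

section Order

variable [Nonempty ι] {η : ι}
  (hη : ∀ k, P.coroot η - P.coroot k ∈ AddSubmonoid.closure (P.coroot '' (b.support : Set ι)))

include hϖ

omit [LinearOrder K] [IsStrictOrderedRing K] [Fintype ι] [P.IsReduced] [Nonempty ι] in
/-- ★★★ **«`Ŵ_a/W_a ≅ L̂/L` … ITS ORDER `f` … IS JUST THE DETERMINANT OF THE MATRIX OF CARTAN INTEGERS»: `[Ŵ_a : W_a] = |det C|`.**
[cite: Humphreys1990, §4.5 ("the determinant of the matrix of Cartan integers")] [cite: IwahoriMatsumoto1965, §1.7 ("DW/D′W ≅ D/D′ ≅ P/P_r")] [cite: Humphreys1972, §13.1] -/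
theorem relIndex_affineWeylGroup_eq_natAbs_det :
    (affineWeylGroup P).relIndex (extendedAffineWeylGroup P) = b.cartanMatrix.det.natAbs := by
  rw [relIndex_affineWeylGroup_extendedAffineWeylGroup P, weightLattice_eq_span_fundamental b hϖ,
    relIndex_rootSpan_span_fundamental_eq_natAbs_det hϖ]

include hη in
/-- ★★★ **`|Ω| = [P : P_r] = |det C|`** («the order of the group `Ω` (i.e. the index `[P : P_r]`)»; row g45-#10 `|Ω| = [Ŵ_a : W_a]`).
[cite: IwahoriMatsumoto1965, §1.7 Corollary 1.19 ("The order of the group Ω (i.e. the index [P : P_r])")] [cite: Humphreys1972, §13.1] -/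
theorem natCard_stabilizer_eq_natAbs_det :
    Nat.card {o : M ≃ᵃ[K] M // o ∈ extendedAffineWeylGroup P ∧
        o '' {x : M | ∀ i, b.IsPos i → 0 < P.coroot' i x ∧ P.coroot' i x < 1} =
          {x : M | ∀ i, b.IsPos i → 0 < P.coroot' i x ∧ P.coroot' i x < 1}} = b.cartanMatrix.det.natAbs := by
  rw [natCard_stabilizer_eq_relIndex b hη, relIndex_affineWeylGroup_eq_natAbs_det b hϖ]

omit [LinearOrder K] [IsStrictOrderedRing K] [P.IsReduced] [Nonempty ι] in
/-- ★★ **`W_a` HAS FINITE INDEX IN `Ŵ_a`** (`det C ≠ 0`, tree g32). [cite: Humphreys1990, §4.2 ("a normal subgroup of finite index")] [cite: IwahoriMatsumoto1965, §1.7] -/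
theorem relIndex_affineWeylGroup_ne_zero : (affineWeylGroup P).relIndex (extendedAffineWeylGroup P) ≠ 0 := by
  rw [relIndex_affineWeylGroup_eq_natAbs_det b hϖ, ne_eq, Int.natAbs_eq_zero]
  exact det_cartanMatrix_ne_zero b

include hη in
/-- ★★ **«THUS `Ω` IS A FINITE ABELIAN GROUP»: `Ω` IS FINITE** (abelian is row g44-#11 `stabilizer_mul_comm`). [cite: IwahoriMatsumoto1965, §1.7 ("Thus Ω is a finite abelian group isomorphic to the center 𝔷 of G̃_ℂ")] -/
theorem finite_stabilizer_fundamentalAlcove :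
    Finite {o : M ≃ᵃ[K] M // o ∈ extendedAffineWeylGroup P ∧
        o '' {x : M | ∀ i, b.IsPos i → 0 < P.coroot' i x ∧ P.coroot' i x < 1} =
          {x : M | ∀ i, b.IsPos i → 0 < P.coroot' i x ∧ P.coroot' i x < 1}} := by
  apply Nat.finite_of_card_ne_zero
  rw [natCard_stabilizer_eq_natAbs_det b hϖ hη, ne_eq, Int.natAbs_eq_zero]
  exact det_cartanMatrix_ne_zero b

end Order

/-! ## §3 Corollary 1.19 as printed: `|Ω| = 1 + N₁` -/

section SpecialNodes

variable [Nonempty ι] [P.IsIrreducible] {η : ι}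
  (hη : ∀ k, P.coroot η - P.coroot k ∈ AddSubmonoid.closure (P.coroot '' (b.support : Set ι)))
  {f : ι → ℤ} (hf : P.coroot η = ∑ j ∈ b.support, f j • P.coroot j)

include hϖ hη hf

/-- ★★★ **COROLLARY 1.19: `|Ω| = 1 + N₁`, `N₁` THE NUMBER OF `i ∈ Δ` WITH `n_i = 1` IN THE HIGHEST COROOT `α_η^∨ = Σ n_i α_i^∨`** (IM's `(α₀, ε_i) = 1`;
the special nodes of `Δ`, row g45-#7) — `|Ω| = |det C|` (§2) and `#{i : n_i = 1} = |det C| - 1` (tree g39-#4), `det C ≠ 0`. [cite: IwahoriMatsumoto1965, §1.7 Corollary 1.19 ("The order of the group Ω (i.e. the index [P : P_r]) is equal to 1 + N₁ where N₁ is the number of i's such that (α₀, ε_i) = 1")] -/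
theorem natCard_stabilizer_eq_one_add_card_filter :
    Nat.card {o : M ≃ᵃ[K] M // o ∈ extendedAffineWeylGroup P ∧
        o '' {x : M | ∀ i, b.IsPos i → 0 < P.coroot' i x ∧ P.coroot' i x < 1} =
          {x : M | ∀ i, b.IsPos i → 0 < P.coroot' i x ∧ P.coroot' i x < 1}} =
      1 + (Finset.univ.filter fun i : b.support ↦ f i = 1).card := by
  rw [natCard_stabilizer_eq_natAbs_det b hϖ hη, card_filter_coeff_eq_one_eq_natAbs_det_sub_one hϖ hη hf]
  have h : b.cartanMatrix.det.natAbs ≠ 0 := by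
    rw [ne_eq, Int.natAbs_eq_zero]; exact det_cartanMatrix_ne_zero b
  omega

end SpecialNodes

/-! ## §4 `P(DW, t) = |det C| · P(D'W, t)` -/

section Series

variable [Nonempty ι] [DecidablePred b.IsPos] {η : ι}
  (hη : ∀ k, P.coroot η - P.coroot k ∈ AddSubmonoid.closure (P.coroot '' (b.support : Set ι)))
  {M' : CoxeterMatrix (Option b.support)} (cs : CoxeterSystem M' (affineWeylGroup P)) (hcs : ∀ o, cs.simple o = wallReflection b η o)

include hϖ hη hcs

/-- ★★ **«`P(DW, t) = |Ω|·P(D'W, t)`» WITH `|Ω| = |det C|`**: the number of `σ ∈ Ŵ_a` whose alcove is separated from `A∘` by `n` hyperplanes is `|det C|`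
times the number of `w ∈ W_a` of length `n` (row g47-#3 `ncard_extendedAffineWeylGroup_sep_eq`). [cite: IwahoriMatsumoto1965, §1.10 ("P(DW, t) = |Ω|·P(D′W, t)") and §1.7 Corollary 1.19] -/
theorem ncard_extendedAffineWeylGroup_sep_eq_natAbs_det_mul (n : ℕ) :
    {σ : M ≃ᵃ[K] M | σ ∈ extendedAffineWeylGroup P ∧ ∃ k : ι → ℤ,
        σ '' {x : M | ∀ i, b.IsPos i → 0 < P.coroot' i x ∧ P.coroot' i x < 1} = alcove P k ∧
          ∑ i, |k i - (if b.IsPos i then (0 : ℤ) else -1)| = 2 * n}.ncard =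
      b.cartanMatrix.det.natAbs * {w : affineWeylGroup P | cs.length w = n}.ncard := by
  rw [ncard_extendedAffineWeylGroup_sep_eq b cs hcs hη n, natCard_stabilizer_eq_natAbs_det b hϖ hη]

end Series

end Base

end Literature.LinearAlgebra.RootSystem
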